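import Summits.SmoothPoincare4.SmoothPoincare4.Theorems.CylinderEntropyCylinderRungTwoGraphicalIsSphere
import Summits.SmoothPoincare4.SmoothPoincare4.Theorems.EuclideanOrigamiRoundCreaseStandardCrease
import Literature.AlgebraicTopology.FundamentalGroup.SphereSimplyConnected
import Mathlib.Topology.Covering.Basic
import Mathlib.Geometry.Manifold.LocalDiffeomorph
import HarnessLib

/-!
# An immersed shadow of a cross-section of `S⁴ × ℝ` has one sheet

Stub `stub_oneSheet` of line `killing-flux` for the crux `CylinderEntropy.CylinderRungTwo`
(stmt-SmoothPoincare4-7631).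

## What

Let `N = {z ∈ ℝ⁶ | ∑_{i<5} zᵢ² = 1} = S⁴ × ℝ` and let `ι : M → ℝ⁶` be a smooth embedding of a compact
connected boundaryless `4`-manifold `M` with image in `N` whose *shadow* `truncL ∘ ι : M → ℝ⁵`
(`truncL` drops the height coordinate `z₅`) is an immersion (injective differential everywhere).
Then the shadow is injective (`stub_oneSheet`, registered signature): the cross-section is a graph
over `S⁴` with ONE sheet. Together with the landed `stub_graphicalIsSphere` this gives `M ≃ₘ S⁴`.

## Proof (fact-free, covering route)

The shadow lands in `S⁴` (`truncL_mem_sphere`), so it co-restricts to `g : M → S⁴`, smooth by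
`ContMDiff.codRestrict_sphere`, with injective differential by the chain rule through
`Subtype.val ∘ g = truncL ∘ ι`; as `dim M = dim S⁴ = 4`, the inverse function theorem (tree
`Literature.Topology.FourManifolds.isLocalDiffeomorphAt_of_mfderiv_injective`) makes `g` a local
diffeomorphism, hence a local homeomorphism, hence (compact Hausdorff source, Hausdorff target,
Mathlib `isLocalHomeomorph_iff_isCoveringMap`) a covering map. The base `S⁴` is simply connected
(tree `simplyConnectedSpace_euclideanSphere`) and locally path connected, and `M` is connected, so
the covering `g` is injective (lift the identity of `S⁴` to a section and use uniqueness of lifts,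
Hatcher Props. 1.33–1.34; sibling `EuclideanOrigami.RoundCreaseStandard.injective_of_isCoveringMap`);
injectivity transfers to `truncL ∘ ι = Subtype.val ∘ g`.

## References

* [HatcherAT2002] A. Hatcher, *Algebraic Topology*, CUP 2002, Props. 1.33–1.34.
* [HirschDT1976] M. W. Hirsch, *Differential Topology*, GTM 33, Springer 1976, Ch. 1 §3.
-/

-- the prescribed namespace `Summit.SmoothPoincare4.SmoothPoincare4.…` repeats `SmoothPoincare4`
set_option linter.dupNamespace false

noncomputable section

open scoped Manifold ContDiff
open Function Set
open Literature.Geometry.Riemannian.SphericalCylinderEntropy (truncL)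

namespace Summit.SmoothPoincare4.SmoothPoincare4.Theorems.CylinderRungTwo.KillingFlux

/-- **An immersed shadow has one sheet** (stub `stub_oneSheet` of line `killing-flux`, crux
`CylinderEntropy.CylinderRungTwo`). If `M` is a compact connected boundaryless `4`-manifold and
`ι : M → ℝ⁶` a smooth embedding into the cylinder `N = {∑_{i<5} zᵢ² = 1}` whose shadow
`truncL ∘ ι : M → ℝ⁵` has everywhere injective differential, then the shadow is injective: its
co-restriction `M → S⁴` is a local diffeomorphism (inverse function theorem), hence a covering map
(compact source), hence injective since `S⁴` is simply connected and `M` is connected.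
[cite: HatcherAT2002, Props. 1.33–1.34] -/
theorem stub_oneSheet :
    ∀ (M : Type) [TopologicalSpace M] [T2Space M] [SecondCountableTopology M]
      [ChartedSpace (EuclideanSpace ℝ (Fin 4)) M] [IsManifold (𝓡 4) ∞ M] [CompactSpace M]
      [ConnectedSpace M] (ι : M → EuclideanSpace ℝ (Fin 6)),
      Manifold.IsSmoothEmbedding (𝓡 4) (𝓡 6) ∞ ι →
      (∀ x, ∑ i : Fin 5, ι x (Fin.castSucc i) ^ 2 = 1) →
      (∀ x : M, Function.Injective
        (mfderiv (𝓡 4) (𝓡 5) ((truncL : EuclideanSpace ℝ (Fin 6) → EuclideanSpace ℝ (Fin 5)) ∘ ι) x)) →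
      Function.Injective ((truncL : EuclideanSpace ℝ (Fin 6) → EuclideanSpace ℝ (Fin 5)) ∘ ι) := by
  intro M _ _ _ _ _ _ _ ι hι hN hdinj
  haveI : Fact (Module.finrank ℝ (EuclideanSpace ℝ (Fin 5)) = 4 + 1) := ⟨finrank_euclideanSpace_fin⟩
  -- the shadow lands in the unit sphere `S⁴ ⊂ ℝ⁵`
  have hmem : ∀ x, ((truncL : EuclideanSpace ℝ (Fin 6) → EuclideanSpace ℝ (Fin 5)) ∘ ι) x ∈
      Metric.sphere (0 : EuclideanSpace ℝ (Fin 5)) 1 := fun x => truncL_mem_sphere (hN x)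
  -- its co-restriction `g : M → S⁴`
  set g : M → Metric.sphere (0 : EuclideanSpace ℝ (Fin 5)) 1 := Set.codRestrict _ _ hmem with hg
  have hval_g : (Subtype.val ∘ g) =
      ((truncL : EuclideanSpace ℝ (Fin 6) → EuclideanSpace ℝ (Fin 5)) ∘ ι) := rfl
  -- smoothness of the shadow and of `g`
  have hsm : ContMDiff (𝓡 4) (𝓡 5) ∞
      ((truncL : EuclideanSpace ℝ (Fin 6) → EuclideanSpace ℝ (Fin 5)) ∘ ι) :=
    truncL.contDiff.comp_contMDiff hι.contMDiff
  have hgs : ContMDiff (𝓡 4) (𝓡 4) ∞ g := hsm.codRestrict_sphere hmem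
  -- the differential of `g` is injective (chain rule through `Subtype.val ∘ g = truncL ∘ ι`)
  have hval : ContMDiff (𝓡 4) (𝓡 5) ∞
      (Subtype.val : Metric.sphere (0 : EuclideanSpace ℝ (Fin 5)) 1 → EuclideanSpace ℝ (Fin 5)) :=
    contMDiff_coe_sphere
  have hdg : ∀ x, Injective (mfderiv (𝓡 4) (𝓡 4) g x) := by
    intro x
    have hgd : MDifferentiableAt (𝓡 4) (𝓡 4) g x := (hgs x).mdifferentiableAt (by simp)
    have hvd : MDifferentiableAt (𝓡 4) (𝓡 5)
        (Subtype.val : Metric.sphere (0 : EuclideanSpace ℝ (Fin 5)) 1 → EuclideanSpace ℝ (Fin 5))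
        (g x) := (hval (g x)).mdifferentiableAt (by simp)
    have h := hdinj x
    rw [← hval_g, mfderiv_comp x hvd hgd] at h
    exact Injective.of_comp h
  -- `g` is a local diffeomorphism (inverse function theorem, equal dimensions)
  have hloc : IsLocalDiffeomorph (𝓡 4) (𝓡 4) ∞ g := fun x =>
    Literature.Topology.FourManifolds.isLocalDiffeomorphAt_of_mfderiv_injective isOpen_univ
      (mem_univ x) hgs.contMDiffOn (by simp) rfl (hdg x)
  -- hence a covering map (`M` compact Hausdorff, `S⁴` Hausdorff)
  have hcov : IsCoveringMap g := isLocalHomeomorph_iff_isCoveringMap.1 hloc.isLocalHomeomorph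
  -- `S⁴` is simply connected and locally path connected, `M` is connected: `g` is injective
  haveI : SimplyConnectedSpace (Metric.sphere (0 : EuclideanSpace ℝ (Fin 5)) 1) :=
    Literature.AlgebraicTopology.FundamentalGroup.simplyConnectedSpace_euclideanSphere 4 (by norm_num)
  haveI : LocallyPathConnectedSpace (Metric.sphere (0 : EuclideanSpace ℝ (Fin 5)) 1) :=
    ChartedSpace.locallyPathConnectedSpace (EuclideanSpace ℝ (Fin 4))
      (Metric.sphere (0 : EuclideanSpace ℝ (Fin 5)) 1)
  have hginj : Injective g := EuclideanOrigami.RoundCreaseStandard.injective_of_isCoveringMap hcov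
  -- transfer along `Subtype.val ∘ g = truncL ∘ ι`
  rw [← hval_g]
  exact Subtype.val_injective.comp hginj

end Summit.SmoothPoincare4.SmoothPoincare4.Theorems.CylinderRungTwo.KillingFlux

end
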